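import Literature.Probability.Percolation.SiteLoopDensity
import Literature.Probability.Percolation.ArmEventsInterface
import HarnessLib

/-!
# Interface loops of `𝕋` wind with one sign; the DKKMO type is the sign of the winding numbers

Topic `Literature/Probability/Percolation` (proofs and two elementary lattice definitions,
`hexDart`, `hexDartRev`; no named fact is introduced). Companion to `FullPlaneCNL.lean` (target:
the named fact `exists_isFullPlaneCNLLaw`, Camia–Newman's full-plane loop law in DKKMO's typed
metric `d_CN`) and to `SiteLoopDensity.lean`; the site-percolation analogue of
`InterfaceLoopWindingSign.lean` (bond percolation on `ℤ²`). In DKKMO's space `C` the interface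
loops are *typed*: in the tree's rendering (`siteLoopConfig`, `FullPlaneCNL.lean`) a loop `γ` of
the hexagonal lattice with open sites on its left (`IsSiteInterfaceLoop ω γ`, `CLE6.lean`) has
type `1` iff its shoelace sum `shoelace (γ.support.map hexCenter)` is positive (anticlockwise:
"the exterior boundary of a primal cluster", arXiv:2012.11672v2 §1.2), type `0` otherwise. To
compare types of nearby loops — lattice against lattice at two meshes, or lattice against
continuum — one needs the type as a *topological* functional of the oriented loop: the sign of
its winding numbers. This file proves that characterisation, without the Jordan curve theorem,
from the winding-number bookkeeping of `SiteInterfaceWinding.lean` (the jump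
`W(left) - W(right) = 1` across every crossed edge, constancy across uncrossed edges, vanishing
far away):

* `IsSiteInterfaceLoop.loopWind_dichotomy` — **one-signedness at the lattice sites**: either all
  left (open) sites have winding number `1`, all right (closed) sites `0` and every site `0` or
  `1`, or all left sites `0`, all right sites `-1` and every site `0` or `-1`. (All left sites
  agree, `loopWind_leftPt_eq_loopWind_leftPt_zero`: consecutive ones are joined by an uncrossed
  open–open edge; collapsing the left value `p₀` onto `p₀ - 1` gives a function constant across
  every edge of `𝕋`, hence equal to its value far away along a lattice ray,
  `collapse_loopWind_eq`.)
* `hexDart a k` — the darts of the hexagonal lattice parametrised by (left site, direction):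
  `hexDart a k : hexFace a k → hexFace a (k+1)` crosses the edge `{a, a + hexDir k}` with `a` on
  its left (`SiteLoopDensity.lean`); a bijection `Site 2 × Fin 6 ≃ hexGraph.Dart`
  (`hexDart_bijective`, through `eq_of_triEdgeFaces_eq` and the neighbour tables of the faces),
  intertwining the reversal `hexDartRev (a, k) = (a + hexDir k, k + 3)` with `Dart.symm`
  (`hexDart_rev`). For an interface loop, `hexDart a k ∈ γ.darts ↔ ∃ i, lv i = a ∧ rv i = a +
  hexDir k` (`hexDart_mem_darts_iff`), so the gradient `W(a) - W(a + hexDir k)` is the signed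
  indicator of the loop crossing the edge (`loopWind_sub_loopWind_add_hexDir`).
* `IsSiteInterfaceLoop.shoelace_eq_sqrt_three_mul_finsum_loopWind` — **the discrete Green
  formula** `shoelace (γ.support.map hexCenter) = √3 · Σ_a W(a)` (sum over all sites; `√3/2` is
  the area of a hexagon of `𝕋*`): `√3 Σ_a W(a) = Σ_{(a,k)} W(a) cross(hexDart a k)` (the six cross
  forms around a site sum to the shoelace sum `√3` of the hexagon, `sum_crossForm_hexFace`,
  `shoelace_hexAround`), pairing darts with their opposites halves this into
  `½ Σ (W(a) - W(a + hexDir k)) cross(hexDart a k) = ½ (shoelace + shoelace)`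
  (`shoelace_support_eq_sum_darts`).
* Consequences: `sqrt_three_le_abs_shoelace` (`|shoelace| ≥ √3`, so `shoelace ≠ 0`),
  `shoelace_pos_iff` (**type `1` ⟺ the left sites have winding number `1`**),
  `loopWind_eq_zero_or_one_of_shoelace_pos` / `loopWind_eq_zero_or_neg_one_of_shoelace_nonpos`
  and the values at left/right sites: a type-`1` loop winds `0` or `1` about every site (`1`
  about the open sites along it), a type-`0` loop `0` or `-1` (`-1` about the closed sites along
  it).

## References

* F. Camia, C. M. Newman, Comm. Math. Phys. 268 (2006) 1–38, §4 (cluster boundaries as oriented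
  loops of the hexagonal lattice), §5.2 (orientation of the loops) [CamiaNewman2006].
* H. Duminil-Copin, K. K. Kozlowski, D. Krachun, I. Manolescu, M. Oulamara, arXiv:2012.11672v2
  (2026), §1.2 (types `F₀ ⊔ F₁`) [arXiv201211672v2].
* L. V. Ahlfors, *Complex Analysis*, 3rd ed. (1979), §4.2.1 (winding numbers).
-/

noncomputable section

open Set Metric Complex

namespace Literature.Probability.Percolation

open LatticeModels RandomPlanarGeometry Literature.Topology.PlaneTopology

section Signs

variable {ω : SiteConfig (Site 2)} {f₀ : HexVertex} {w : hexGraph.Walk f₀ f₀}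
  (hw : IsSiteInterfaceLoop ω w) {δ : ℝ} (hδ : 0 < δ)

include hw hδ

/-- **All left sites carry the same winding number**: consecutive left (open) sites are equal or
adjacent through an open–open edge, which the loop does not cross. [folklore] -/
theorem IsSiteInterfaceLoop.loopWind_leftPt_eq_loopWind_leftPt_zero {i : ℕ} (hi : i < w.length) :
    loopWind δ w (hw.leftPt δ i) = loopWind δ w (hw.leftPt δ 0) := by
  induction i with
  | zero => rfl
  | succ i ih =>
    rw [← ih (by omega), IsSiteInterfaceLoop.leftPt, IsSiteInterfaceLoop.leftPt]
    have hab : hw.lv (i + 1) = hw.lv i ∨ triGraph.Adj (hw.lv (i + 1)) (hw.lv i) := by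
      rcases hw.lv_succ_eq_or_adj hi with h | h
      · exact Or.inl h
      · exact Or.inr h.symm
    exact hw.loopWind_triMeshPoint_eq_of_mem hδ hab (hw.lv_mem hi) (hw.lv_mem (by omega))

/-- **All right sites carry the winding number of the left sites minus one** (the jump across
the crossed edge of each step). [folklore] -/
theorem IsSiteInterfaceLoop.loopWind_rightPt_eq {i : ℕ} (hi : i < w.length) :
    loopWind δ w (hw.rightPt δ i) = loopWind δ w (hw.leftPt δ 0) - 1 := by
  have h := hw.loopWind_leftPt_sub_loopWind_rightPt hδ hi
  rw [hw.loopWind_leftPt_eq_loopWind_leftPt_zero hδ hi] at h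
  omega

/-- **Across an edge of `𝕋` the winding number is constant, unless the edge is crossed**, in
which case its endpoints are a left and a right site of some step (in some order). [folklore] -/
theorem IsSiteInterfaceLoop.loopWind_triMeshPoint_eq_or_exists {a b : Site 2} (hab : triGraph.Adj a b) :
    loopWind δ w (triMeshPoint δ a) = loopWind δ w (triMeshPoint δ b) ∨
      ∃ i < w.length, (a = hw.lv i ∧ b = hw.rv i) ∨ (a = hw.rv i ∧ b = hw.lv i) := by
  by_cases h : ∃ i < w.length, (a = hw.lv i ∧ b = hw.rv i) ∨ (a = hw.rv i ∧ b = hw.lv i)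
  · exact Or.inr h
  · exact Or.inl (hw.loopWind_triMeshPoint_eq_of_adj hδ (Or.inr hab) fun i hi ↦
      ⟨fun hh ↦ h ⟨i, hi, Or.inl hh⟩, fun hh ↦ h ⟨i, hi, Or.inr hh⟩⟩)

/-- The collapse map of the sign argument: identify the left value `p₀` with the right value
`p₀ - 1`, fix everything else. [folklore] -/
private def collapse (p₀ v : ℤ) : ℤ := if v = p₀ then p₀ - 1 else v

omit hw hδ in
/-- The collapse of the left value. [folklore] -/
private theorem collapse_self (p₀ : ℤ) : collapse p₀ p₀ = p₀ - 1 := if_pos rfl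

omit hw hδ in
/-- The collapse fixes the right value. [folklore] -/
private theorem collapse_pred (p₀ : ℤ) : collapse p₀ (p₀ - 1) = p₀ - 1 := if_neg (by omega)

/-- **The collapsed winding number is the same at adjacent sites**: an uncrossed edge has equal
winding numbers; a crossed edge has the values `p₀` (left) and `p₀ - 1` (right), identified by
the collapse. [folklore] -/
theorem IsSiteInterfaceLoop.collapse_loopWind_eq_of_adj {a b : Site 2} (hab : triGraph.Adj a b) :
    collapse (loopWind δ w (hw.leftPt δ 0)) (loopWind δ w (triMeshPoint δ a)) =
      collapse (loopWind δ w (hw.leftPt δ 0)) (loopWind δ w (triMeshPoint δ b)) := by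
  rcases hw.loopWind_triMeshPoint_eq_or_exists hδ hab with h | ⟨i, hi, h⟩
  · rw [h]
  · have hl : loopWind δ w (triMeshPoint δ (hw.lv i)) = loopWind δ w (hw.leftPt δ 0) :=
      hw.loopWind_leftPt_eq_loopWind_leftPt_zero hδ hi
    have hr : loopWind δ w (triMeshPoint δ (hw.rv i)) = loopWind δ w (hw.leftPt δ 0) - 1 :=
      hw.loopWind_rightPt_eq hδ hi
    rcases h with ⟨rfl, rfl⟩ | ⟨rfl, rfl⟩
    · rw [hl, hr, collapse_self, collapse_pred]
    · rw [hl, hr, collapse_self, collapse_pred]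

/-- The collapsed winding number is transported along the lattice ray `a, a + e₀, a + 2e₀, …`.
[folklore] -/
theorem IsSiteInterfaceLoop.collapse_loopWind_raySite (a : Site 2) (k : ℕ) :
    collapse (loopWind δ w (hw.leftPt δ 0)) (loopWind δ w (triMeshPoint δ (raySite a k))) =
      collapse (loopWind δ w (hw.leftPt δ 0)) (loopWind δ w (triMeshPoint δ a)) := by
  induction k with
  | zero => rw [raySite_zero]
  | succ k ih =>
    rw [← ih]
    exact (hw.collapse_loopWind_eq_of_adj hδ (adj_raySite_succ a k)).symm

/-- **The collapsed winding number is the collapse of `0` at every site** (transport along a ray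
to a site farther from the origin than the trace, where the winding number vanishes). [folklore] -/
theorem IsSiteInterfaceLoop.collapse_loopWind_eq (a : Site 2) :
    collapse (loopWind δ w (hw.leftPt δ 0)) (loopWind δ w (triMeshPoint δ a)) =
      collapse (loopWind δ w (hw.leftPt δ 0)) 0 := by
  have hlen : 0 < w.length := by have := hw.isCycle.three_le_length; omega
  obtain ⟨ρ, hρ⟩ := exists_polyTrace_subset_closedBall hlen δ
  -- a ray site far away
  obtain ⟨k, hk⟩ := exists_nat_gt (ρ / δ + ‖triEmbed a‖)
  have hfar : ρ < δ * ‖triEmbed (raySite a k)‖ := by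
    have h1 : (k : ℝ) - ‖triEmbed (a - 0)‖ ≤ ‖triEmbed (raySite a k - 0)‖ := sub_le_norm_triEmbed_raySite_sub a 0 k
    rw [sub_zero, sub_zero] at h1
    have h2 : ρ / δ < ‖triEmbed (raySite a k)‖ := by linarith
    rwa [div_lt_iff₀' hδ] at h2
  have h0 : loopWind δ w (triMeshPoint δ (raySite a k)) = 0 :=
    loopWind_triMeshPoint_eq_zero_of_lt_norm hδ hlen hρ hfar
  rw [← hw.collapse_loopWind_raySite hδ a k, h0]

/-- **The winding numbers of an interface loop at the lattice sites have one sign.** Either the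
left sites have winding number `1`, the right sites `0`, and every site `0` or `1`
(anticlockwise loop: the open cluster on the left is enclosed); or the left sites have winding
number `0`, the right sites `-1`, and every site `0` or `-1` (clockwise loop: the closed cluster
on the right is enclosed). (Camia–Newman, CMP 268 (2006), §4 and §5.2: cluster boundaries are
oriented loops, counterclockwise iff the open cluster is inside; here by winding numbers and
without the Jordan curve theorem, as for `ℤ²` bonds in `InterfaceLoopWindingSign.lean`.)
[cite: CamiaNewman2006, §4] -/
theorem IsSiteInterfaceLoop.loopWind_dichotomy :
    (loopWind δ w (hw.leftPt δ 0) = 1 ∧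
        ∀ a : Site 2, loopWind δ w (triMeshPoint δ a) = 0 ∨ loopWind δ w (triMeshPoint δ a) = 1) ∨
      (loopWind δ w (hw.leftPt δ 0) = 0 ∧
        ∀ a : Site 2, loopWind δ w (triMeshPoint δ a) = 0 ∨ loopWind δ w (triMeshPoint δ a) = -1) := by
  have key := hw.collapse_loopWind_eq hδ
  by_cases h0 : loopWind δ w (hw.leftPt δ 0) = 0
  · refine Or.inr ⟨h0, fun a ↦ ?_⟩
    have h := key a
    rw [h0] at h
    unfold collapse at h
    rw [if_pos rfl] at h
    by_cases h1 : loopWind δ w (triMeshPoint δ a) = 0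
    · exact Or.inl h1
    · rw [if_neg h1] at h
      exact Or.inr (by omega)
  · have hc0 : collapse (loopWind δ w (hw.leftPt δ 0)) 0 = 0 := if_neg (Ne.symm h0)
    have h1 : loopWind δ w (hw.leftPt δ 0) = 1 := by
      have h := key (hw.lv 0)
      change collapse (loopWind δ w (hw.leftPt δ 0)) (loopWind δ w (hw.leftPt δ 0)) = _ at h
      rw [collapse_self, hc0] at h
      omega
    refine Or.inl ⟨h1, fun a ↦ ?_⟩
    have h := key a
    rw [hc0] at h
    unfold collapse at h
    by_cases h2 : loopWind δ w (triMeshPoint δ a) = loopWind δ w (hw.leftPt δ 0)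
    · exact Or.inr (h2.trans h1)
    · rw [if_neg h2] at h
      exact Or.inl h

/-- The left sites have winding number `0` or `1`. [folklore] -/
theorem IsSiteInterfaceLoop.loopWind_leftPt_zero_eq_zero_or_one :
    loopWind δ w (hw.leftPt δ 0) = 1 ∨ loopWind δ w (hw.leftPt δ 0) = 0 := by
  rcases hw.loopWind_dichotomy hδ with ⟨h, -⟩ | ⟨h, -⟩
  · exact Or.inl h
  · exact Or.inr h

/-- **Winding numbers of interface loops at lattice sites are `-1`, `0` or `1`.** [folklore] -/
theorem IsSiteInterfaceLoop.abs_loopWind_triMeshPoint_le_one (a : Site 2) :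
    |loopWind δ w (triMeshPoint δ a)| ≤ 1 := by
  rcases hw.loopWind_dichotomy hδ with ⟨-, h⟩ | ⟨-, h⟩ <;> rcases h a with h | h <;> rw [h] <;> decide

/-- In the anticlockwise case (`wind (left) = 1`) all site winding numbers are `≥ 0`, in the
clockwise case (`wind (left) = 0`) all are `≤ 0`: the sign `2 · wind(left) - 1 ∈ {±1}` makes
every site winding number nonnegative. [folklore] -/
theorem IsSiteInterfaceLoop.sign_mul_loopWind_nonneg (a : Site 2) :
    0 ≤ (2 * loopWind δ w (hw.leftPt δ 0) - 1) * loopWind δ w (triMeshPoint δ a) := by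
  rcases hw.loopWind_dichotomy hδ with ⟨h1, h⟩ | ⟨h1, h⟩ <;> rcases h a with h | h <;> rw [h1, h] <;> decide

end Signs
/-! ### The shoelace sum of a closed walk as a sum over its darts -/

/-- The antisymmetric form `p × q = p₁ q₂ - q₁ p₂` of the shoelace sum. [folklore] -/
def crossForm (p q : ℂ) : ℝ := p.re * q.im - q.re * p.im

/-- `crossForm` is antisymmetric. [folklore] -/
theorem crossForm_swap (p q : ℂ) : crossForm q p = -crossForm p q := by
  unfold crossForm; ring

/-- `crossForm p p = 0`. [folklore] -/
@[simp] theorem crossForm_self (p : ℂ) : crossForm p p = 0 := by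
  unfold crossForm; ring

/-- **The shoelace sum of the (embedded) support of a closed walk is the sum of the cross forms
of its darts** (the closing pair of the cyclic list is `(u, u)`, which contributes `0`). [folklore] -/
theorem shoelace_support_eq_sum_darts {V : Type*} {G : SimpleGraph V} {u : V} (p : G.Walk u u) (f : V → ℂ) :
    shoelace (p.support.map f) = (p.darts.map fun d ↦ crossForm (f d.fst) (f d.snd)).sum := by
  have hsupp : p.support.map f = (p.darts.map fun d ↦ f d.fst) ++ [f u] := by
    conv_lhs => rw [← p.map_fst_darts_append]
    rw [List.map_append, List.map_map]
    rfl
  have hrot : (p.support.map f).rotate 1 = (p.darts.map fun d ↦ f d.snd) ++ [f u] := by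
    rw [← p.cons_tail_support, List.map_cons, List.rotate_cons_succ, List.rotate_zero, ← p.map_snd_darts,
      List.map_map]
    rfl
  have hlen : (p.darts.map fun d ↦ f d.fst).length = (p.darts.map fun d ↦ f d.snd).length := by simp
  unfold shoelace
  rw [hrot, hsupp, List.zip_append hlen]
  simp only [List.zip_cons_cons, List.zip_nil_right, List.map_append, List.map_cons, List.map_nil,
    List.sum_append, List.sum_cons, List.sum_nil, add_zero, sub_self]
  rw [List.zip_map', List.map_map]
  rfl

/-! ### The darts of the hexagonal lattice, parametrised by (left site, direction) -/

/-- **The `k`-th hexagon dart around the site `a`**: from `hexFace a k` to `hexFace a (k + 1)`; it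
crosses the edge `{a, a + hexDir k}` of `𝕋` with `a` on its left. [folklore] -/
def hexDart (a : Site 2) (k : Fin 6) : hexGraph.Dart :=
  ⟨(hexFace a k, hexFace a (k + 1)), (hexAddHom a).map_adj (hexGraph_adj_hexFace₀ k)⟩

/-- The endpoints of `hexDart a k`. [folklore] -/
@[simp] theorem hexDart_toProd (a : Site 2) (k : Fin 6) : (hexDart a k).toProd = (hexFace a k, hexFace a (k + 1)) := rfl

/-- The dart of `𝕋` crossed by `hexDart a k` has it as (left face, right face) = (head, tail). [folklore] -/
theorem triEdgeFaces_hexDir_eq_hexDart (a : Site 2) (k : Fin 6) :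
    triEdgeFaces ⟨(a, a + hexDir k), triGraph_adj_add_hexDir a k⟩ = ((hexDart a k).snd, (hexDart a k).fst) :=
  triEdgeFaces_hexDir a k

/-- The outer directions are pairwise distinct. [folklore] -/
theorem hexDir_injective : Function.Injective hexDir := by decide

/-- Every unit vector of `𝕋` is an outer direction `hexDir k`. [folklore] -/
theorem exists_hexDir_eq_of_adj {a b : Site 2} (h : triGraph.Adj a b) : ∃ k : Fin 6, b = a + hexDir k := by
  rcases (triGraph_adj_iff_eq_add a b).1 h with h | h | h | h | h | h
  · exact ⟨5, h⟩
  · exact ⟨2, h⟩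
  · exact ⟨0, h⟩
  · exact ⟨3, h⟩
  · exact ⟨4, by rw [h]; congr 1; decide⟩
  · exact ⟨1, by rw [h]; congr 1; decide⟩

/-- **Two `(site, direction)` pairs with the same hexagon dart coincide**: the dart determines the
crossed dart of `𝕋` (`eq_of_triEdgeFaces_eq`). [folklore] -/
theorem hexDart_injective : Function.Injective fun p : Site 2 × Fin 6 ↦ hexDart p.1 p.2 := by
  rintro ⟨a, k⟩ ⟨a', k'⟩ h
  simp only at h
  have hf : triEdgeFaces ⟨(a, a + hexDir k), triGraph_adj_add_hexDir a k⟩ =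
      triEdgeFaces ⟨(a', a' + hexDir k'), triGraph_adj_add_hexDir a' k'⟩ := by
    rw [triEdgeFaces_hexDir_eq_hexDart, triEdgeFaces_hexDir_eq_hexDart, h]
  obtain ⟨rfl, h2⟩ := eq_of_triEdgeFaces_eq _ _ hf
  simp only [add_right_inj] at h2
  simp [hexDir_injective h2]

/-- **Every dart of the hexagonal lattice is some `hexDart a k`** (the three neighbours of an
up face `(x, 0)` are reached by the darts `hexDart x 0`, `hexDart (x + e₀) 2`, `hexDart (x + e₁) 4`,
those of a down face `(x, 1)` by `hexDart (x + e₀) 1`, `hexDart (x + e₀ + e₁) 3`, `hexDart (x + e₁) 5`).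
[folklore] -/
theorem exists_hexDart_eq (D : hexGraph.Dart) : ∃ p : Site 2 × Fin 6, hexDart p.1 p.2 = D := by
  obtain ⟨⟨⟨x, l⟩, ⟨y, l'⟩⟩, hFG⟩ := D
  have key : ∀ (a : Site 2) (k : Fin 6), (hexFace a k, hexFace a (k + 1)) = ((x, l), (y, l')) →
      ∃ p : Site 2 × Fin 6, hexDart p.1 p.2 = ⟨((x, l), (y, l')), hFG⟩ :=
    fun a k h ↦ ⟨(a, k), SimpleGraph.Dart.ext _ _ h⟩
  fin_cases l <;> fin_cases l'
  · exact absurd hFG (not_hexGraph_adj_of_snd_eq_holds _ _ rfl)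
  · rcases (hexGraph_adj_iff_of_snd_eq_zero_holds x y).1 hFG with rfl | rfl | rfl
    · refine key (y + Pi.single 1 1) 4 ?_
      simp only [hexFace, hexAddHom_apply, hexFace₀]
      refine Prod.ext (Prod.ext ?_ rfl) (Prod.ext ?_ rfl) <;> simp
    · refine key x 0 ?_
      simp only [hexFace, hexAddHom_apply, hexFace₀]
      refine Prod.ext (Prod.ext ?_ rfl) (Prod.ext ?_ rfl)
      · simp
      · simp [sub_eq_add_neg]
    · refine key (x + Pi.single 0 1) 2 ?_
      simp only [hexFace, hexAddHom_apply, hexFace₀]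
      refine Prod.ext (Prod.ext ?_ rfl) (Prod.ext ?_ rfl)
      · simp
      · show x + Pi.single 0 1 + (-Pi.single 0 1 - Pi.single 1 1) = x - Pi.single 1 1
        have h : (Pi.single 0 1 : Site 2) + (-Pi.single 0 1 - Pi.single 1 1) = -Pi.single 1 1 := by decide
        rw [add_assoc, h, sub_eq_add_neg]
  · rcases (hexGraph_adj_iff_of_snd_eq_one x y).1 hFG with rfl | rfl | rfl
    · refine key (y + Pi.single 0 1) 1 ?_
      simp only [hexFace, hexAddHom_apply, hexFace₀]
      refine Prod.ext (Prod.ext ?_ rfl) (Prod.ext ?_ rfl) <;> simp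
    · refine key (x + Pi.single 0 1 + Pi.single 1 1) 3 ?_
      simp only [hexFace, hexAddHom_apply, hexFace₀]
      refine Prod.ext (Prod.ext ?_ rfl) (Prod.ext ?_ rfl) <;> simp
    · refine key (x + Pi.single 1 1) 5 ?_
      simp only [hexFace, hexAddHom_apply, hexFace₀]
      refine Prod.ext (Prod.ext ?_ rfl) (Prod.ext ?_ rfl) <;> simp
  · exact absurd hFG (not_hexGraph_adj_of_snd_eq_holds _ _ rfl)

/-- The parametrisation `(a, k) ↦ hexDart a k` of the darts of the hexagonal lattice is a
bijection. [folklore] -/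
theorem hexDart_bijective : Function.Bijective fun p : Site 2 × Fin 6 ↦ hexDart p.1 p.2 :=
  ⟨hexDart_injective, fun D ↦ exists_hexDart_eq D⟩

/-- The faces of the opposite dart: around the outer site `a + hexDir k`, the faces
`hexFace a (k+1)`, `hexFace a k` are the `(k+3)`-rd and `(k+4)`-th. Verified at the origin by
`decide`. [folklore] -/
theorem hexFace_add_hexDir (a : Site 2) (k : Fin 6) :
    hexFace (a + hexDir k) (k + 3) = hexFace a (k + 1) ∧ hexFace (a + hexDir k) (k + 4) = hexFace a k := by
  have h : ∀ k : Fin 6, (hexDir k + (hexFace₀ (k + 3)).1, (hexFace₀ (k + 3)).2) = hexFace₀ (k + 1) ∧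
      (hexDir k + (hexFace₀ (k + 4)).1, (hexFace₀ (k + 4)).2) = hexFace₀ k := by decide
  obtain ⟨h1, h2⟩ := h k
  constructor
  · change ((a + hexDir k) + (hexFace₀ (k + 3)).1, (hexFace₀ (k + 3)).2) = (a + (hexFace₀ (k + 1)).1, (hexFace₀ (k + 1)).2)
    rw [← h1, add_assoc]
  · change ((a + hexDir k) + (hexFace₀ (k + 4)).1, (hexFace₀ (k + 4)).2) = (a + (hexFace₀ k).1, (hexFace₀ k).2)
    conv_rhs => rw [← h2]
    rw [add_assoc]

/-- `hexDir (k + 3) = - hexDir k`. [folklore] -/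
theorem hexDir_add_three (k : Fin 6) : hexDir (k + 3) = -hexDir k := by
  fin_cases k <;> decide

/-- **The reversal of the dart parametrisation**: `σ (a, k) = (a + hexDir k, k + 3)` sends
`hexDart a k` to its opposite dart. [folklore] -/
theorem hexDart_rev (a : Site 2) (k : Fin 6) : hexDart (a + hexDir k) (k + 3) = (hexDart a k).symm := by
  refine SimpleGraph.Dart.ext _ _ ?_
  rw [hexDart_toProd, SimpleGraph.Dart.symm_toProd, hexDart_toProd, Prod.swap_prod_mk,
    show (k + 3 + 1 : Fin 6) = k + 4 by rw [add_assoc]; rfl, (hexFace_add_hexDir a k).1, (hexFace_add_hexDir a k).2]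

/-- The reversal map on parameters. [folklore] -/
def hexDartRev (p : Site 2 × Fin 6) : Site 2 × Fin 6 := (p.1 + hexDir p.2, p.2 + 3)

/-- The reversal map is an involution. [folklore] -/
theorem hexDartRev_hexDartRev (p : Site 2 × Fin 6) : hexDartRev (hexDartRev p) = p := by
  obtain ⟨a, k⟩ := p
  simp only [hexDartRev, hexDir_add_three, add_neg_cancel_right, Prod.mk.injEq, true_and]
  rw [add_assoc]
  revert k
  decide

/-- The reversal map is a bijection. [folklore] -/
theorem hexDartRev_bijective : Function.Bijective hexDartRev :=
  Function.Involutive.bijective hexDartRev_hexDartRev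

/-! ### The darts of an interface loop in the `(site, direction)` parametrisation -/

/-- In a trail, a dart and its opposite do not both occur. [folklore] -/
theorem not_mem_darts_symm_of_isTrail {V : Type*} {G : SimpleGraph V} {u v : V} {p : G.Walk u v}
    (hp : p.IsTrail) {d : G.Dart} (hd : d ∈ p.darts) : d.symm ∉ p.darts := by
  intro hd'
  have hnd : p.darts.Nodup := hp.edges_nodup.of_map _
  have hinj := (List.nodup_map_iff_inj_on hnd).1 hp.edges_nodup d hd d.symm hd' d.edge_symm.symm
  exact d.symm_ne.symm hinj

/-- The sum of the six cross forms around a site is the shoelace sum of the hexagon, `√3`. [folklore] -/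
theorem sum_crossForm_hexFace (a : Site 2) :
    ∑ k : Fin 6, crossForm (hexCenter (hexFace a k)) (hexCenter (hexFace a (k + 1))) = Real.sqrt 3 := by
  rw [← shoelace_hexAround a, shoelace_support_eq_sum_darts, hexAround, SimpleGraph.Walk.darts_map,
    darts_hexAround₀]
  simp only [List.map_cons, List.map_nil, List.sum_cons, List.sum_nil, SimpleGraph.Hom.mapDart_apply,
    Prod.map_apply, Fin.sum_univ_six]
  simp only [add_zero, show (5 : Fin 6) + 1 = 0 from rfl, show (4 : Fin 6) + 1 = 5 from rfl,
    show (3 : Fin 6) + 1 = 4 from rfl, show (2 : Fin 6) + 1 = 3 from rfl, show (1 : Fin 6) + 1 = 2 from rfl,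
    show (0 : Fin 6) + 1 = 1 from rfl]
  change _ = crossForm (hexCenter (hexFace a 0)) (hexCenter (hexFace a 1)) +
    (crossForm (hexCenter (hexFace a 1)) (hexCenter (hexFace a 2)) +
      (crossForm (hexCenter (hexFace a 2)) (hexCenter (hexFace a 3)) +
        (crossForm (hexCenter (hexFace a 3)) (hexCenter (hexFace a 4)) +
          (crossForm (hexCenter (hexFace a 4)) (hexCenter (hexFace a 5)) +
            crossForm (hexCenter (hexFace a 5)) (hexCenter (hexFace a 0))))))
  ring

section DartsOfLoop

variable {ω : SiteConfig (Site 2)} {f₀ : HexVertex} {w : hexGraph.Walk f₀ f₀}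
  (hw : IsSiteInterfaceLoop ω w)

include hw

/-- **A hexagon dart belongs to the interface loop iff it is the crossed dart of some step**: 
`hexDart a k ∈ w.darts ↔ ∃ i < w.length, lv i = a ∧ rv i = a + hexDir k`. [folklore] -/
theorem IsSiteInterfaceLoop.hexDart_mem_darts_iff {a : Site 2} {k : Fin 6} :
    hexDart a k ∈ w.darts ↔ ∃ i < w.length, hw.lv i = a ∧ hw.rv i = a + hexDir k := by
  constructor
  · intro hd
    obtain ⟨i, hi, hdi⟩ := List.mem_iff_getElem.1 hd
    have hi' : i < w.length := by rwa [SimpleGraph.Walk.length_darts] at hi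
    rw [SimpleGraph.Walk.darts_getElem_eq_getVert i hi] at hdi
    have h1 : w.getVert i = hexFace a k := congrArg (fun d : hexGraph.Dart ↦ d.toProd.1) hdi
    have h2 : w.getVert (i + 1) = hexFace a (k + 1) := congrArg (fun d : hexGraph.Dart ↦ d.toProd.2) hdi
    obtain ⟨hadj, hfaces, -⟩ := hw.dart_spec hi'
    rw [h1, h2] at hfaces
    have hf : triEdgeFaces ⟨(hw.lv i, hw.rv i), hadj⟩ = triEdgeFaces ⟨(a, a + hexDir k), triGraph_adj_add_hexDir a k⟩ := by
      rw [hfaces, triEdgeFaces_hexDir]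
    obtain ⟨hl, hr⟩ := eq_of_triEdgeFaces_eq _ _ hf
    exact ⟨i, hi', hl, hr⟩
  · rintro ⟨i, hi, hl, hr⟩
    obtain ⟨hadj, hfaces, -⟩ := hw.dart_spec hi
    have hd : (⟨(hw.lv i, hw.rv i), hadj⟩ : triGraph.Dart) = ⟨(a, a + hexDir k), triGraph_adj_add_hexDir a k⟩ :=
      SimpleGraph.Dart.ext _ _ (Prod.ext hl hr)
    rw [hd, triEdgeFaces_hexDir] at hfaces
    simp only [Prod.mk.injEq] at hfaces
    have hi' : i < w.darts.length := by rwa [SimpleGraph.Walk.length_darts]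
    have hget : w.darts[i] = hexDart a k := by
      rw [SimpleGraph.Walk.darts_getElem_eq_getVert i hi']
      exact SimpleGraph.Dart.ext _ _ (Prod.ext hfaces.2.symm hfaces.1.symm)
    exact hget ▸ List.getElem_mem hi'

/-- The opposite of a hexagon dart belongs to the loop iff the reversed edge is crossed. [folklore] -/
theorem IsSiteInterfaceLoop.hexDart_symm_mem_darts_iff {a : Site 2} {k : Fin 6} :
    (hexDart a k).symm ∈ w.darts ↔ ∃ i < w.length, hw.lv i = a + hexDir k ∧ hw.rv i = a := by
  rw [← hexDart_rev, hw.hexDart_mem_darts_iff, hexDir_add_three, add_neg_cancel_right]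

/-- **The gradient of the winding number across the edge `{a, a + hexDir k}`** is the signed
indicator of the loop crossing it: `+1` if the hexagon dart `hexDart a k` (with `a` on its left)
belongs to the loop, `-1` if its opposite does, `0` otherwise. [folklore] -/
theorem IsSiteInterfaceLoop.loopWind_sub_loopWind_add_hexDir {δ : ℝ} (hδ : 0 < δ) (a : Site 2) (k : Fin 6) :
    (loopWind δ w (triMeshPoint δ a) - loopWind δ w (triMeshPoint δ (a + hexDir k)) : ℤ) =
      (if hexDart a k ∈ w.darts then 1 else 0) - (if (hexDart a k).symm ∈ w.darts then 1 else 0) := by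
  by_cases h1 : hexDart a k ∈ w.darts
  · have h2 : (hexDart a k).symm ∉ w.darts := not_mem_darts_symm_of_isTrail hw.isCycle.isTrail h1
    rw [if_pos h1, if_neg h2]
    obtain ⟨i, hi, hl, hr⟩ := hw.hexDart_mem_darts_iff.1 h1
    have h := hw.loopWind_leftPt_sub_loopWind_rightPt hδ hi
    rw [IsSiteInterfaceLoop.leftPt, IsSiteInterfaceLoop.rightPt, hl, hr] at h
    rw [h]; rfl
  · rw [if_neg h1]
    by_cases h2 : (hexDart a k).symm ∈ w.darts
    · rw [if_pos h2]
      obtain ⟨i, hi, hl, hr⟩ := hw.hexDart_symm_mem_darts_iff.1 h2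
      have h := hw.loopWind_leftPt_sub_loopWind_rightPt hδ hi
      rw [IsSiteInterfaceLoop.leftPt, IsSiteInterfaceLoop.rightPt, hl, hr] at h
      omega
    · rw [if_neg h2, sub_zero]
      refine sub_eq_zero.2 (hw.loopWind_triMeshPoint_eq_of_adj hδ (Or.inr (triGraph_adj_add_hexDir a k))
        fun i hi ↦ ⟨fun hh ↦ h1 ?_, fun hh ↦ h2 ?_⟩)
      · exact hw.hexDart_mem_darts_iff.2 ⟨i, hi, hh.1.symm, hh.2.symm⟩
      · exact hw.hexDart_symm_mem_darts_iff.2 ⟨i, hi, hh.2.symm, hh.1.symm⟩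

end DartsOfLoop

/-! ### The discrete Green formula: shoelace sum = `√3 ·` sum of the site winding numbers -/

/-- Reindexing a finite sum along a bijection of the ambient type, when the finite set carries
the supports of both the function and its reindexing (through `finsum`). [folklore] -/
theorem sum_eq_sum_comp_of_bijective {α M : Type*} [AddCommMonoid M] {s : Finset α} (g : α → M)
    (e : α → α) (he : Function.Bijective e) (hg : Function.support g ⊆ ↑s)
    (hge : Function.support (g ∘ e) ⊆ ↑s) : ∑ x ∈ s, g x = ∑ x ∈ s, g (e x) :=
  calc ∑ x ∈ s, g x = ∑ᶠ i, g i := (finsum_eq_sum_of_support_subset g hg).symm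
    _ = ∑ᶠ i, (g ∘ e) i := (finsum_eq_of_bijective e he fun _ ↦ rfl).symm
    _ = ∑ x ∈ s, (g ∘ e) x := finsum_eq_sum_of_support_subset _ hge

/-- A finite sum of a function supported in the finite set is its `finsum`, reindexed along a
bijection `e : β → α` from another type. [folklore] -/
theorem sum_eq_finsum_comp_of_bijective {α β M : Type*} [AddCommMonoid M] {s : Finset α} (g : α → M)
    (hg : Function.support g ⊆ ↑s) (e : β → α) (he : Function.Bijective e) :
    ∑ x ∈ s, g x = ∑ᶠ y, g (e y) := by
  rw [← finsum_eq_sum_of_support_subset g hg]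
  exact (finsum_eq_of_bijective e he fun _ ↦ rfl).symm

section Green

variable {ω : SiteConfig (Site 2)} {f₀ : HexVertex} {w : hexGraph.Walk f₀ f₀}
  (hw : IsSiteInterfaceLoop ω w) {δ : ℝ} (hδ : 0 < δ)

include hw hδ

/-- **A finite set of sites carrying everything**: the sites with non-zero winding number, those
with a neighbour of non-zero winding number, and the left and right sites of all steps (all lie
within `ρ + 2δ` of the origin if the trace lies in `B̄(0, ρ)`; the mesh is locally finite). [folklore] -/
theorem IsSiteInterfaceLoop.exists_finset_sites :
    ∃ B : Finset (Site 2), (∀ a, loopWind δ w (triMeshPoint δ a) ≠ 0 → a ∈ B) ∧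
      (∀ a (k : Fin 6), loopWind δ w (triMeshPoint δ (a + hexDir k)) ≠ 0 → a ∈ B) ∧
      (∀ i < w.length, hw.lv i ∈ B ∧ hw.rv i ∈ B) := by
  have hlen : 0 < w.length := by have := hw.isCycle.three_le_length; omega
  obtain ⟨ρ, hρ⟩ := exists_polyTrace_subset_closedBall hlen δ
  have hfin := triMeshVertices_finite_holds (isBounded_closedBall (x := (0 : ℂ)) (r := ρ + 2 * δ)) hδ
  refine ⟨hfin.toFinset, fun a ha ↦ ?_, fun a k ha ↦ ?_, fun i hi ↦ ⟨?_, ?_⟩⟩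
  all_goals rw [Set.Finite.mem_toFinset, mem_triMeshVertices_iff, mem_closedBall, dist_zero_right]
  · -- non-zero winding number: within `ρ`
    have h : ¬ ρ < δ * ‖triEmbed a‖ := fun h ↦ ha (loopWind_triMeshPoint_eq_zero_of_lt_norm hδ hlen hρ h)
    rw [triMeshPoint, norm_mul, Complex.norm_real, Real.norm_of_nonneg hδ.le]
    linarith [not_lt.1 h]
  · have h : ¬ ρ < δ * ‖triEmbed (a + hexDir k)‖ := fun h ↦
      ha (loopWind_triMeshPoint_eq_zero_of_lt_norm hδ hlen hρ h)
    have h1 : ‖triEmbed a‖ ≤ ‖triEmbed (a + hexDir k)‖ + 1 := by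
      have := norm_triEmbed_eq_one_of_adj (triGraph_adj_add_hexDir a k)
      calc ‖triEmbed a‖ = ‖(triEmbed a - triEmbed (a + hexDir k)) + triEmbed (a + hexDir k)‖ := by
            rw [sub_add_cancel]
        _ ≤ ‖triEmbed a - triEmbed (a + hexDir k)‖ + ‖triEmbed (a + hexDir k)‖ := norm_add_le _ _
        _ = ‖triEmbed (a + hexDir k)‖ + 1 := by rw [this, add_comm]
    rw [triMeshPoint, norm_mul, Complex.norm_real, Real.norm_of_nonneg hδ.le]
    nlinarith [not_lt.1 h, norm_nonneg (triEmbed (a + hexDir k))]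
  · -- the left site is within `δ` of a point of the trace
    have h1 := (hw.dist_polyPt_leftPt_le hδ.le hi).1
    have h2 : polyPt δ w i ∈ closedBall (0 : ℂ) ρ :=
      hρ (polyPiece_subset_polyTrace hi (left_mem_segment ℝ _ _))
    rw [mem_closedBall, dist_zero_right] at h2
    rw [dist_comm] at h1
    have h3 : ‖hw.leftPt δ i‖ ≤ ρ + δ :=
      (norm_le_norm_add_norm_sub' (hw.leftPt δ i) (polyPt δ w i)).trans (by rw [← dist_eq_norm]; linarith)
    change ‖hw.leftPt δ i‖ ≤ ρ + 2 * δ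
    linarith
  · have h1 := (hw.dist_polyPt_leftPt_le hδ.le hi).1
    have h2 : polyPt δ w i ∈ closedBall (0 : ℂ) ρ :=
      hρ (polyPiece_subset_polyTrace hi (left_mem_segment ℝ _ _))
    rw [mem_closedBall, dist_zero_right] at h2
    rw [dist_comm] at h1
    have h3 : ‖hw.leftPt δ i‖ ≤ ρ + δ :=
      (norm_le_norm_add_norm_sub' (hw.leftPt δ i) (polyPt δ w i)).trans (by rw [← dist_eq_norm]; linarith)
    have h4 := hw.dist_leftPt_rightPt hδ.le hi
    change ‖hw.rightPt δ i‖ ≤ ρ + 2 * δ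
    have h5 : ‖hw.rightPt δ i‖ ≤ ‖hw.leftPt δ i‖ + δ :=
      (norm_le_norm_add_norm_sub' (hw.rightPt δ i) (hw.leftPt δ i)).trans
        (by rw [← dist_eq_norm, dist_comm, h4])
    linarith

/-- **The discrete Green formula for interface loops.** The shoelace sum of the polygon of face
centres of an interface loop equals `√3` times the sum of its winding numbers over all lattice
sites (a finite sum: the winding number vanishes far away). Proof: `√3 = ` the shoelace sum of a
hexagon `= Σ_k` of the cross forms of the six darts around any site (`sum_crossForm_hexFace`), so
`√3 Σ_a W(a) = Σ_{(a,k)} W(a) · cross(hexDart a k)`; pairing each dart with its opposite (the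
involution `hexDartRev`, cross form antisymmetric) turns this into
`½ Σ_{(a,k)} (W(a) - W(a + hexDir k)) · cross(hexDart a k)`, and the gradient of the winding
number across an edge is the signed indicator of the loop crossing it
(`loopWind_sub_loopWind_add_hexDir`: the jump lemma), which leaves `½ (shoelace + shoelace)`
(`shoelace_support_eq_sum_darts`; every dart of the hexagonal lattice is a unique `hexDart a k`,
`hexDart_bijective`). (The `ℤ²`-bond analogue is `IsInterfaceLoop.loopSignedArea_eq_sum_wind` of
`InterfaceLoopWindingSign.lean`.) [folklore] -/
theorem IsSiteInterfaceLoop.shoelace_eq_sqrt_three_mul_finsum_loopWind :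
    shoelace (w.support.map hexCenter) = Real.sqrt 3 * ∑ᶠ a : Site 2, (loopWind δ w (triMeshPoint δ a) : ℝ) := by
  classical
  obtain ⟨B, hB1, hB2, hB3⟩ := hw.exists_finset_sites hδ
  -- notation
  set W : Site 2 → ℝ := fun a ↦ (loopWind δ w (triMeshPoint δ a) : ℝ) with hW
  set c : Site 2 × Fin 6 → ℝ := fun p ↦ crossForm (hexCenter (hexFace p.1 p.2)) (hexCenter (hexFace p.1 (p.2 + 1)))
    with hc
  have hWsupp : Function.support W ⊆ ↑B := fun a ha ↦ hB1 a (by simpa [hW] using ha)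
  -- the double sum
  set S : ℝ := ∑ p ∈ B ×ˢ (Finset.univ : Finset (Fin 6)), W p.1 * c p with hS
  -- Claim A: summing around each site first
  have hA : S = Real.sqrt 3 * ∑ a ∈ B, W a := by
    rw [hS, Finset.sum_product, Finset.mul_sum]
    refine Finset.sum_congr rfl fun a _ ↦ ?_
    simp only [hc]
    rw [← Finset.mul_sum, sum_crossForm_hexFace, mul_comm]
  -- Claim B: reindexing along the reversal `σ`
  have hB : S = -∑ p ∈ B ×ˢ (Finset.univ : Finset (Fin 6)), W (p.1 + hexDir p.2) * c p := by
    have hsupp : Function.support (fun p : Site 2 × Fin 6 ↦ W p.1 * c p) ⊆ ↑(B ×ˢ (Finset.univ : Finset (Fin 6))) := by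
      intro p hp
      rw [Function.mem_support] at hp
      simp only [Finset.coe_product, Finset.coe_univ, Set.mem_prod, Set.mem_univ, and_true]
      exact hB1 p.1 (by intro h; apply hp; simp [hW, h])
    have hsupp' : Function.support ((fun p : Site 2 × Fin 6 ↦ W p.1 * c p) ∘ hexDartRev) ⊆
        ↑(B ×ˢ (Finset.univ : Finset (Fin 6))) := by
      intro p hp
      rw [Function.mem_support, Function.comp_apply] at hp
      simp only [Finset.coe_product, Finset.coe_univ, Set.mem_prod, Set.mem_univ, and_true]
      exact hB2 p.1 p.2 (by intro h; apply hp; simp [hW, hexDartRev, h])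
    rw [hS, sum_eq_sum_comp_of_bijective _ hexDartRev hexDartRev_bijective hsupp hsupp', ← Finset.sum_neg_distrib]
    refine Finset.sum_congr rfl fun p _ ↦ ?_
    obtain ⟨a, k⟩ := p
    simp only [hexDartRev, hc]
    rw [show (k + 3 + 1 : Fin 6) = k + 4 by rw [add_assoc]; rfl, (hexFace_add_hexDir a k).1,
      (hexFace_add_hexDir a k).2, crossForm_swap]
    ring
  -- hence `2 S = Σ (W(a) - W(a + hexDir k)) · c`
  have h2S : 2 * S = ∑ p ∈ B ×ˢ (Finset.univ : Finset (Fin 6)),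
      ((if hexDart p.1 p.2 ∈ w.darts then c p else 0) - (if (hexDart p.1 p.2).symm ∈ w.darts then c p else 0)) := by
    rw [two_mul]
    nth_rw 2 [hB]
    rw [hS, ← sub_eq_add_neg, ← Finset.sum_sub_distrib]
    refine Finset.sum_congr rfl fun p _ ↦ ?_
    have h := hw.loopWind_sub_loopWind_add_hexDir hδ p.1 p.2
    have h' : W p.1 - W (p.1 + hexDir p.2) =
        ((if hexDart p.1 p.2 ∈ w.darts then 1 else 0) - (if (hexDart p.1 p.2).symm ∈ w.darts then 1 else 0) : ℤ) := by
      rw [← h]; simp [hW]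
    rw [← sub_mul, h']
    push_cast
    split_ifs <;> ring
  -- Claim C: the darts of the loop sum to the shoelace sum
  have hnodup : w.darts.Nodup := hw.isCycle.isTrail.edges_nodup.of_map _
  have hshoe : shoelace (w.support.map hexCenter) =
      ∑ D ∈ w.darts.toFinset, crossForm (hexCenter D.fst) (hexCenter D.snd) := by
    rw [shoelace_support_eq_sum_darts, List.sum_toFinset _ hnodup]
  set F' : hexGraph.Dart → ℝ := fun D ↦ if D ∈ w.darts then crossForm (hexCenter D.fst) (hexCenter D.snd) else 0
    with hF'
  have hF'sum : ∑ᶠ D, F' D = shoelace (w.support.map hexCenter) := by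
    have hsupp : Function.support F' ⊆ ↑w.darts.toFinset := by
      intro D hD
      rw [Function.mem_support] at hD
      rw [List.coe_toFinset, Set.mem_setOf_eq]
      by_contra h
      exact hD (by simp [hF', h])
    rw [finsum_eq_sum_of_support_subset F' hsupp, hshoe]
    refine Finset.sum_congr rfl fun D hD ↦ ?_
    rw [List.mem_toFinset] at hD
    simp [hF', hD]
  have hC : ∑ p ∈ B ×ˢ (Finset.univ : Finset (Fin 6)), (if hexDart p.1 p.2 ∈ w.darts then c p else 0) =
      shoelace (w.support.map hexCenter) := by
    have hsupp : Function.support (fun p : Site 2 × Fin 6 ↦ if hexDart p.1 p.2 ∈ w.darts then c p else 0) ⊆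
        ↑(B ×ˢ (Finset.univ : Finset (Fin 6))) := by
      intro p hp
      rw [Function.mem_support] at hp
      simp only [Finset.coe_product, Finset.coe_univ, Set.mem_prod, Set.mem_univ, and_true]
      have hmem : hexDart p.1 p.2 ∈ w.darts := by by_contra h; exact hp (if_neg h)
      obtain ⟨i, hi, hl, -⟩ := hw.hexDart_mem_darts_iff.1 hmem
      exact hl ▸ (hB3 i hi).1
    rw [← hF'sum, ← finsum_eq_sum_of_support_subset _ hsupp]
    exact finsum_eq_of_bijective (fun p : Site 2 × Fin 6 ↦ hexDart p.1 p.2) hexDart_bijective fun p ↦ rfl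
  -- Claim D: the opposite darts sum to minus the shoelace sum
  have hD : ∑ p ∈ B ×ˢ (Finset.univ : Finset (Fin 6)), (if (hexDart p.1 p.2).symm ∈ w.darts then c p else 0) =
      -shoelace (w.support.map hexCenter) := by
    have hsupp : Function.support (fun p : Site 2 × Fin 6 ↦ if (hexDart p.1 p.2).symm ∈ w.darts then c p else 0) ⊆
        ↑(B ×ˢ (Finset.univ : Finset (Fin 6))) := by
      intro p hp
      rw [Function.mem_support] at hp
      simp only [Finset.coe_product, Finset.coe_univ, Set.mem_prod, Set.mem_univ, and_true]
      have hmem : (hexDart p.1 p.2).symm ∈ w.darts := by by_contra h; exact hp (if_neg h)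
      obtain ⟨i, hi, -, hr⟩ := hw.hexDart_symm_mem_darts_iff.1 hmem
      exact hr ▸ (hB3 i hi).2
    have hbij : Function.Bijective fun p : Site 2 × Fin 6 ↦ (hexDart p.1 p.2).symm :=
      SimpleGraph.Dart.symm_involutive.bijective.comp hexDart_bijective
    rw [← hF'sum, ← finsum_neg_distrib, ← finsum_eq_sum_of_support_subset _ hsupp]
    refine finsum_eq_of_bijective (fun p : Site 2 × Fin 6 ↦ (hexDart p.1 p.2).symm) hbij fun p ↦ ?_
    simp only [hF', hc, SimpleGraph.Dart.symm_toProd, hexDart_toProd, Prod.fst_swap, Prod.snd_swap]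
    split_ifs
    · rw [crossForm_swap]
    · rw [neg_zero]
  -- assemble
  have hSeq : S = shoelace (w.support.map hexCenter) := by
    have h : 2 * S = 2 * shoelace (w.support.map hexCenter) := by
      rw [h2S, Finset.sum_sub_distrib, hC, hD]; ring
    linarith
  rw [← hSeq, hA, finsum_eq_sum_of_support_subset W hWsupp]

end Green

/-! ### The orientation type is the sign of the winding numbers -/

section TypeSign

variable {ω : SiteConfig (Site 2)} {f₀ : HexVertex} {w : hexGraph.Walk f₀ f₀}
  (hw : IsSiteInterfaceLoop ω w) {δ : ℝ} (hδ : 0 < δ)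

include hw hδ

/-- **Anticlockwise loops have shoelace sum `≥ √3`**: if the left sites have winding number `1`,
all site winding numbers are `0` or `1` and the left site of step `0` contributes `1`. [folklore] -/
theorem IsSiteInterfaceLoop.sqrt_three_le_shoelace (h1 : loopWind δ w (hw.leftPt δ 0) = 1) :
    Real.sqrt 3 ≤ shoelace (w.support.map hexCenter) := by
  have hlen : 0 < w.length := by have := hw.isCycle.three_le_length; omega
  obtain ⟨B, hB1, -, hB3⟩ := hw.exists_finset_sites hδ
  have hcase : ∀ a : Site 2, loopWind δ w (triMeshPoint δ a) = 0 ∨ loopWind δ w (triMeshPoint δ a) = 1 := by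
    rcases hw.loopWind_dichotomy hδ with ⟨-, h⟩ | ⟨h0, -⟩
    · exact h
    · omega
  have hsupp : Function.support (fun a : Site 2 ↦ (loopWind δ w (triMeshPoint δ a) : ℝ)) ⊆ ↑B :=
    fun a ha ↦ hB1 a (by simpa using ha)
  rw [hw.shoelace_eq_sqrt_three_mul_finsum_loopWind hδ, finsum_eq_sum_of_support_subset _ hsupp]
  have hsum : (1 : ℝ) ≤ ∑ a ∈ B, (loopWind δ w (triMeshPoint δ a) : ℝ) := by
    have h := Finset.single_le_sum (f := fun a : Site 2 ↦ (loopWind δ w (triMeshPoint δ a) : ℝ))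
      (fun a _ ↦ by rcases hcase a with h | h <;> simp [h]) (hB3 0 hlen).1
    have h1' : (loopWind δ w (triMeshPoint δ (hw.lv 0)) : ℝ) = 1 := by
      change (loopWind δ w (hw.leftPt δ 0) : ℝ) = 1; exact_mod_cast h1
    rwa [h1'] at h
  have h3 : 0 < Real.sqrt 3 := Real.sqrt_pos.2 (by norm_num)
  nlinarith

/-- **Clockwise loops have shoelace sum `≤ -√3`**: if the left sites have winding number `0`, all
site winding numbers are `0` or `-1` and the right site of step `0` contributes `-1`. [folklore] -/
theorem IsSiteInterfaceLoop.shoelace_le_neg_sqrt_three (h0 : loopWind δ w (hw.leftPt δ 0) = 0) :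
    shoelace (w.support.map hexCenter) ≤ -Real.sqrt 3 := by
  have hlen : 0 < w.length := by have := hw.isCycle.three_le_length; omega
  obtain ⟨B, hB1, -, hB3⟩ := hw.exists_finset_sites hδ
  have hcase : ∀ a : Site 2, loopWind δ w (triMeshPoint δ a) = 0 ∨ loopWind δ w (triMeshPoint δ a) = -1 := by
    rcases hw.loopWind_dichotomy hδ with ⟨h1, -⟩ | ⟨-, h⟩
    · omega
    · exact h
  have hsupp : Function.support (fun a : Site 2 ↦ (loopWind δ w (triMeshPoint δ a) : ℝ)) ⊆ ↑B :=
    fun a ha ↦ hB1 a (by simpa using ha)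
  rw [hw.shoelace_eq_sqrt_three_mul_finsum_loopWind hδ, finsum_eq_sum_of_support_subset _ hsupp]
  have hsum : ∑ a ∈ B, (loopWind δ w (triMeshPoint δ a) : ℝ) ≤ -1 := by
    have h := Finset.single_le_sum (f := fun a : Site 2 ↦ -(loopWind δ w (triMeshPoint δ a) : ℝ))
      (fun a _ ↦ by rcases hcase a with h | h <;> simp [h]) (hB3 0 hlen).2
    have hr : loopWind δ w (hw.rightPt δ 0) = -1 := by rw [hw.loopWind_rightPt_eq hδ hlen, h0]; rfl
    have h1' : (loopWind δ w (triMeshPoint δ (hw.rv 0)) : ℝ) = -1 := by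
      change (loopWind δ w (hw.rightPt δ 0) : ℝ) = -1; exact_mod_cast hr
    rw [h1', neg_neg, Finset.sum_neg_distrib] at h
    linarith
  have h3 : 0 < Real.sqrt 3 := Real.sqrt_pos.2 (by norm_num)
  nlinarith

/-- **The shoelace sum of an interface loop is at least `√3` in absolute value** (in particular
non-zero: the DKKMO type `0 < shoelace` / `shoelace ≤ 0` is a genuine dichotomy). [folklore] -/
theorem IsSiteInterfaceLoop.sqrt_three_le_abs_shoelace : Real.sqrt 3 ≤ |shoelace (w.support.map hexCenter)| := by
  rcases hw.loopWind_leftPt_zero_eq_zero_or_one hδ with h | h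
  · exact (hw.sqrt_three_le_shoelace hδ h).trans (le_abs_self _)
  · have := hw.shoelace_le_neg_sqrt_three hδ h
    rw [le_abs]
    right; linarith

/-- The shoelace sum of an interface loop is non-zero. [folklore] -/
theorem IsSiteInterfaceLoop.shoelace_ne_zero : shoelace (w.support.map hexCenter) ≠ 0 := by
  intro h
  have := hw.sqrt_three_le_abs_shoelace hδ
  rw [h, abs_zero] at this
  exact absurd this (not_le.2 (Real.sqrt_pos.2 (by norm_num)))

/-- **Type `1` ⟺ anticlockwise**: the shoelace sum is positive iff the left (open) sites have
winding number `1`. [folklore] -/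
theorem IsSiteInterfaceLoop.shoelace_pos_iff :
    0 < shoelace (w.support.map hexCenter) ↔ loopWind δ w (hw.leftPt δ 0) = 1 := by
  have h3 : 0 < Real.sqrt 3 := Real.sqrt_pos.2 (by norm_num)
  constructor
  · intro h
    rcases hw.loopWind_leftPt_zero_eq_zero_or_one hδ with h1 | h0
    · exact h1
    · have := hw.shoelace_le_neg_sqrt_three hδ h0
      linarith
  · intro h1
    exact h3.trans_le (hw.sqrt_three_le_shoelace hδ h1)

/-- **Loops of DKKMO type `1` (positive shoelace sum: anticlockwise, the open cluster inside)
have all site winding numbers in `{0, 1}`**, … [folklore] -/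
theorem IsSiteInterfaceLoop.loopWind_eq_zero_or_one_of_shoelace_pos (h : 0 < shoelace (w.support.map hexCenter))
    (a : Site 2) : loopWind δ w (triMeshPoint δ a) = 0 ∨ loopWind δ w (triMeshPoint δ a) = 1 := by
  have h1 := (hw.shoelace_pos_iff hδ).1 h
  rcases hw.loopWind_dichotomy hδ with ⟨-, h'⟩ | ⟨h0, -⟩
  · exact h' a
  · omega

/-- … with winding number `1` at every left (open) site … [folklore] -/
theorem IsSiteInterfaceLoop.loopWind_leftPt_eq_one_of_shoelace_pos (h : 0 < shoelace (w.support.map hexCenter))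
    {i : ℕ} (hi : i < w.length) : loopWind δ w (hw.leftPt δ i) = 1 := by
  rw [hw.loopWind_leftPt_eq_loopWind_leftPt_zero hδ hi]
  exact (hw.shoelace_pos_iff hδ).1 h

/-- … and `0` at every right (closed) site. [folklore] -/
theorem IsSiteInterfaceLoop.loopWind_rightPt_eq_zero_of_shoelace_pos (h : 0 < shoelace (w.support.map hexCenter))
    {i : ℕ} (hi : i < w.length) : loopWind δ w (hw.rightPt δ i) = 0 := by
  rw [hw.loopWind_rightPt_eq hδ hi, (hw.shoelace_pos_iff hδ).1 h]
  rfl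

/-- **Loops of DKKMO type `0` (non-positive shoelace sum: clockwise, the closed cluster inside)
have all site winding numbers in `{0, -1}`**, … [folklore] -/
theorem IsSiteInterfaceLoop.loopWind_eq_zero_or_neg_one_of_shoelace_nonpos (h : shoelace (w.support.map hexCenter) ≤ 0)
    (a : Site 2) : loopWind δ w (triMeshPoint δ a) = 0 ∨ loopWind δ w (triMeshPoint δ a) = -1 := by
  rcases hw.loopWind_dichotomy hδ with ⟨h1, -⟩ | ⟨-, h'⟩
  · exact absurd ((hw.shoelace_pos_iff hδ).2 h1) (not_lt.2 h)
  · exact h' a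

/-- … with winding number `0` at every left (open) site … [folklore] -/
theorem IsSiteInterfaceLoop.loopWind_leftPt_eq_zero_of_shoelace_nonpos (h : shoelace (w.support.map hexCenter) ≤ 0)
    {i : ℕ} (hi : i < w.length) : loopWind δ w (hw.leftPt δ i) = 0 := by
  rw [hw.loopWind_leftPt_eq_loopWind_leftPt_zero hδ hi]
  rcases hw.loopWind_leftPt_zero_eq_zero_or_one hδ with h1 | h0
  · exact absurd ((hw.shoelace_pos_iff hδ).2 h1) (not_lt.2 h)
  · exact h0

/-- … and `-1` at every right (closed) site. [folklore] -/
theorem IsSiteInterfaceLoop.loopWind_rightPt_eq_neg_one_of_shoelace_nonpos (h : shoelace (w.support.map hexCenter) ≤ 0)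
    {i : ℕ} (hi : i < w.length) : loopWind δ w (hw.rightPt δ i) = -1 := by
  have hlen : 0 < w.length := by omega
  rw [hw.loopWind_rightPt_eq hδ hi, hw.loopWind_leftPt_eq_zero_of_shoelace_nonpos hδ h hlen]
  rfl

end TypeSign

end Literature.Probability.Percolation

end
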